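import Mathlib

/-!
# Crux `SelfMixingDichotomy.CoherentScaleExclusion` (stmt-NavierStokesRegularity-1423), line
  `registered`: the load piece of the kinematic witness (`kinWitness_loadPiece`)

Helper file (theorems only; lands `--supports stmt-NavierStokesRegularity-1423`) for the lead's
kinematic witness against the cascade stub of the crux: the swirling core
`uW t x = (1 - t) ^ (-7/8) * expNegInvGlue (4 - ‖x‖² / (1 - t) ^ (3/4)) • J x` for `t < 1`
(else `0`), `J x = (-x₁, x₀, 0)`, blow-up time `T = 1` at `x₀ = 0`, core radius
`ρ(t) = (1 - t) ^ (3/8)`.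

`kinWitness_loadPiece`: there is `κ > 0` such that for every `r ∈ (0, 1)` there are a time
window `(a, b) ⊆ (1 - r², 1)`, a ball `B(c, s) ⊆ B(0, r)` and a floor `m ≥ 0` with
`m ≤ ‖uW t x‖` on `(a, b) × B(c, s)` and `(b - a) s³ m³ / r² ≥ κ r ^ (-1/3)`; a neighbouring
stub turns this into the divergence of the CKN cubic load `C(r)` of `uW` as `r → 0`.

Construction. Write `r = 2 p³` (`p = (r/2) ^ (1/3)`). Take the window `1 - t ∈ (p⁸/2, p⁸)`
(so that the core radius is `≈ p³ = r/2`), the ball `B(c, s)` with `c = (p³/16) e₀`,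
`s = p³/32`, and `m = p⁻⁷ · expNegInvGlue 3 · p³/32`. On the window the amplitude satisfies
`(1 - t) ^ (-7/8) ≥ p⁻⁷`, on the ball `‖x‖ ≤ p³/8` so `‖x‖² / (1 - t) ^ (3/4) ≤ 1` and the
profile is `≥ expNegInvGlue 3`, and `‖J x‖ ≥ |x₀| ≥ p³/32`. The product
`(b - a) s³ m³ / r²` equals `(expNegInvGlue 3)³ / (8 · 32⁶ · p)`, and `p ≤ r ^ (1/3)`.

Everything is proved from Mathlib (standard axioms); no definitions, no named facts.
References: L. Caffarelli, R. Kohn, L. Nirenberg, CPAM 35 (1982), §2 (the scaled load `C(r)`).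
-/

open Metric Set

-- `Summit = Problem` for this summit; the tree lakefile sets `weak.linter.dupNamespace = false`.
set_option linter.dupNamespace false

namespace Summit.NavierStokesRegularity.NavierStokesRegularity.Theorems

/-- Cube-root reparametrisation of the scale: every `r > 0` is `2 p³` with `p > 0` and
`r ^ (-1/3) ≤ p⁻¹` (indeed `p = (r/2) ^ (1/3) ≤ r ^ (1/3)`). -/
theorem kinWitness_loadPiece_cubeRoot {r : ℝ} (hr : 0 < r) :
    ∃ p : ℝ, 0 < p ∧ r = 2 * p ^ 3 ∧ r ^ (-(1/3 : ℝ)) ≤ p⁻¹ := by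
  refine ⟨(r / 2) ^ (1/3 : ℝ), Real.rpow_pos_of_pos (by positivity) _, ?_, ?_⟩
  · have h : ((r / 2) ^ (1/3 : ℝ)) ^ (3 : ℕ) = r / 2 := by
      rw [← Real.rpow_natCast, ← Real.rpow_mul (by positivity)]
      norm_num
    linarith [h]
  · rw [Real.rpow_neg hr.le]
    exact inv_anti₀ (Real.rpow_pos_of_pos (by positivity) _)
      (Real.rpow_le_rpow (by positivity) (by linarith) (by norm_num))

/-- Amplitude floor on the time window: for `0 < θ ≤ p⁸` (and `p > 0`),
`p⁻⁷ = (p⁸) ^ (-7/8) ≤ θ ^ (-7/8)`. -/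
theorem kinWitness_loadPiece_amplitude {p θ : ℝ} (hp : 0 < p) (hθ : 0 < θ) (hθp : θ ≤ p ^ 8) :
    (p ^ 7)⁻¹ ≤ θ ^ (-(7/8 : ℝ)) := by
  have h1 : (p ^ 8) ^ (7/8 : ℝ) = p ^ 7 := by
    rw [← Real.rpow_natCast p 8, ← Real.rpow_mul hp.le]
    norm_num
  rw [Real.rpow_neg hθ.le, ← h1]
  exact inv_anti₀ (Real.rpow_pos_of_pos hθ _) (Real.rpow_le_rpow hθ.le hθp (by norm_num))

/-- Core-radius floor on the time window: for `(p/2)⁸ ≤ θ` (and `p > 0`),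
`(p/2)⁶ = ((p/2)⁸) ^ (3/4) ≤ θ ^ (3/4)`. -/
theorem kinWitness_loadPiece_core {p θ : ℝ} (hp : 0 < p) (hθp : (p / 2) ^ 8 ≤ θ) :
    (p / 2) ^ 6 ≤ θ ^ (3/4 : ℝ) := by
  have h1 : ((p / 2) ^ 8) ^ (3/4 : ℝ) = (p / 2) ^ 6 := by
    rw [← Real.rpow_natCast (p / 2) 8, ← Real.rpow_mul (by positivity)]
    norm_num
  rw [← h1]
  exact Real.rpow_le_rpow (by positivity) hθp (by norm_num)

/-- The swirl direction `J x = (-x₁, x₀, 0)` dominates the first coordinate: `|x₀| ≤ ‖J x‖`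
(its second coordinate is `x₀`). -/
theorem kinWitness_loadPiece_abs_apply_le_norm_swirl (x : EuclideanSpace ℝ (Fin 3)) :
    |x 0| ≤ ‖(WithLp.toLp 2 ![-(x 1), x 0, 0] : EuclideanSpace ℝ (Fin 3))‖ := by
  have h := PiLp.norm_apply_le (WithLp.toLp 2 ![-(x 1), x 0, 0] : EuclideanSpace ℝ (Fin 3)) 1
  simpa using h

/-- First-coordinate control inside a ball: `|x₀ - c₀| ≤ ‖x - c‖`. -/
theorem kinWitness_loadPiece_abs_sub_apply_le (x c : EuclideanSpace ℝ (Fin 3)) :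
    |x 0 - c 0| ≤ ‖x - c‖ := by
  have h := PiLp.norm_apply_le (x - c) 0
  simpa using h

/-- **Load piece of the kinematic witness.** There is `κ > 0` such that for every scale
`r ∈ (0, 1)` the swirling core `uW` is bounded below by some `m ≥ 0` on a product region
`(a, b) × B(c, s) ⊆ (1 - r², 1) × B(0, r)` with `(b - a) s³ m³ / r² ≥ κ r ^ (-1/3)`
(window `1 - t ∈ (p⁸/2, p⁸)`, ball `B((p³/16) e₀, p³/32)`, floor
`m = p⁻⁷ · expNegInvGlue 3 · p³/32`, where `r = 2 p³`; `κ = (expNegInvGlue 3)³ / (8 · 32⁶)`). -/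
theorem kinWitness_loadPiece : ∃ κ : ℝ, 0 < κ ∧ ∀ r : ℝ, 0 < r → r < 1 → ∃ (a b s m : ℝ) (c : EuclideanSpace ℝ (Fin 3)), 1 - r ^ 2 ≤ a ∧ a < b ∧ b ≤ 1 ∧ 0 < s ∧ 0 ≤ m ∧ Metric.ball c s ⊆ Metric.ball (0 : EuclideanSpace ℝ (Fin 3)) r ∧ (∀ t ∈ Set.Ioo a b, ∀ x ∈ Metric.ball c s, m ≤ ‖(fun (t : ℝ) (x : EuclideanSpace ℝ (Fin 3)) => if t < 1 then ((1 - t) ^ (-(7/8 : ℝ)) * expNegInvGlue (4 - ‖x‖ ^ 2 / (1 - t) ^ (3/4 : ℝ))) • (WithLp.toLp 2 ![-(x 1), x 0, 0] : EuclideanSpace ℝ (Fin 3)) else 0) t x‖) ∧ κ * r ^ (-(1/3 : ℝ)) ≤ (b - a) * s ^ 3 * m ^ 3 / r ^ 2 := by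
  have hg : 0 < expNegInvGlue 3 := expNegInvGlue.pos_of_pos (by norm_num)
  refine ⟨(expNegInvGlue 3) ^ 3 / (8 * 32 ^ 6), by positivity, ?_⟩
  intro r hr hr1
  obtain ⟨p, hp, rfl, hpr⟩ := kinWitness_loadPiece_cubeRoot hr
  have hp1 : p ≤ 1 := by
    by_contra h
    have : 1 < p ^ 3 := one_lt_pow₀ (not_le.mp h) (by norm_num)
    linarith
  have h8 : 0 < p ^ 8 := pow_pos hp 8
  have h3 : 0 < p ^ 3 := pow_pos hp 3
  -- the centre of the ball and its basic invariants
  have hcn : ‖(EuclideanSpace.single 0 (p ^ 3 / 16) : EuclideanSpace ℝ (Fin 3))‖ = p ^ 3 / 16 := by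
    rw [PiLp.norm_single, Real.norm_eq_abs, abs_of_pos (by positivity)]
  have hc0 : (EuclideanSpace.single 0 (p ^ 3 / 16) : EuclideanSpace ℝ (Fin 3)) 0 = p ^ 3 / 16 := by
    simp
  -- norm control on the ball `B(c, s)`
  have hball : ∀ x ∈ Metric.ball (EuclideanSpace.single 0 (p ^ 3 / 16) : EuclideanSpace ℝ (Fin 3))
      (p ^ 3 / 32), ‖x‖ < 3 * p ^ 3 / 32 ∧ p ^ 3 / 32 ≤ |x 0| := by
    intro x hx
    rw [Metric.mem_ball, dist_eq_norm] at hx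
    refine ⟨?_, ?_⟩
    · have := norm_sub_norm_le x (EuclideanSpace.single 0 (p ^ 3 / 16) : EuclideanSpace ℝ (Fin 3))
      linarith
    · have h1 := kinWitness_loadPiece_abs_sub_apply_le x
        (EuclideanSpace.single 0 (p ^ 3 / 16) : EuclideanSpace ℝ (Fin 3))
      rw [hc0] at h1
      have h2 := abs_sub_abs_le_abs_sub (p ^ 3 / 16) (x 0)
      rw [abs_sub_comm, abs_of_pos (show (0 : ℝ) < p ^ 3 / 16 by positivity)] at h2
      linarith
  refine ⟨1 - p ^ 8, 1 - p ^ 8 / 2, p ^ 3 / 32, (p ^ 7)⁻¹ * expNegInvGlue 3 * (p ^ 3 / 32),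
    EuclideanSpace.single 0 (p ^ 3 / 16), ?_, ?_, ?_, ?_, ?_, ?_, ?_, ?_⟩
  · -- `1 - r² ≤ a`, i.e. `p⁸ ≤ 4 p⁶`
    have h2 : p ^ 2 ≤ 1 := pow_le_one₀ hp.le hp1
    nlinarith [pow_pos hp 6]
  · linarith
  · linarith
  · positivity
  · positivity
  · -- `B(c, s) ⊆ B(0, r)`
    intro x hx
    rw [Metric.mem_ball, dist_zero_right]
    have := (hball x hx).1
    linarith
  · -- the pointwise floor
    intro t ht x hx
    obtain ⟨hta, htb⟩ := ht
    obtain ⟨hxn, hx0⟩ := hball x hx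
    have ht1 : t < 1 := by linarith
    have hθ : 0 < 1 - t := by linarith
    have hθu : 1 - t ≤ p ^ 8 := by linarith
    have hθl : (p / 2) ^ 8 ≤ 1 - t := by
      have : (p / 2) ^ 8 = p ^ 8 / 256 := by ring
      linarith
    dsimp only
    rw [if_pos ht1, norm_smul, Real.norm_eq_abs,
      abs_of_nonneg (mul_nonneg (Real.rpow_nonneg hθ.le _) (expNegInvGlue.nonneg _))]
    have hA : (p ^ 7)⁻¹ ≤ (1 - t) ^ (-(7/8 : ℝ)) := kinWitness_loadPiece_amplitude hp hθ hθu
    have hG : expNegInvGlue 3 ≤ expNegInvGlue (4 - ‖x‖ ^ 2 / (1 - t) ^ (3/4 : ℝ)) := by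
      apply expNegInvGlue.monotone
      have hcore : (p / 2) ^ 6 ≤ (1 - t) ^ (3/4 : ℝ) := kinWitness_loadPiece_core hp hθl
      have hpos : 0 < (1 - t) ^ (3/4 : ℝ) := Real.rpow_pos_of_pos hθ _
      have hx2 : ‖x‖ ^ 2 ≤ (p / 2) ^ 6 := by
        have e : (p / 2) ^ 6 = (p ^ 3 / 8) ^ 2 := by ring
        rw [e]
        exact pow_le_pow_left₀ (norm_nonneg _) (by linarith) 2
      have hq : ‖x‖ ^ 2 / (1 - t) ^ (3/4 : ℝ) ≤ 1 := by
        rw [div_le_one hpos]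
        linarith
      show (3 : ℝ) ≤ 4 - ‖x‖ ^ 2 / (1 - t) ^ (3/4 : ℝ)
      linarith
    have hJ : p ^ 3 / 32 ≤ ‖(WithLp.toLp 2 ![-(x 1), x 0, 0] : EuclideanSpace ℝ (Fin 3))‖ :=
      hx0.trans (kinWitness_loadPiece_abs_apply_le_norm_swirl x)
    have hAG : 0 ≤ (1 - t) ^ (-(7/8 : ℝ)) * expNegInvGlue (4 - ‖x‖ ^ 2 / (1 - t) ^ (3/4 : ℝ)) :=
      mul_nonneg (Real.rpow_nonneg hθ.le _) (expNegInvGlue.nonneg _)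
    calc (p ^ 7)⁻¹ * expNegInvGlue 3 * (p ^ 3 / 32)
        ≤ (1 - t) ^ (-(7/8 : ℝ)) * expNegInvGlue (4 - ‖x‖ ^ 2 / (1 - t) ^ (3/4 : ℝ))
            * (p ^ 3 / 32) :=
          mul_le_mul_of_nonneg_right
            (mul_le_mul hA hG (expNegInvGlue.nonneg _) (Real.rpow_nonneg hθ.le _))
            (by positivity)
      _ ≤ (1 - t) ^ (-(7/8 : ℝ)) * expNegInvGlue (4 - ‖x‖ ^ 2 / (1 - t) ^ (3/4 : ℝ))
            * ‖(WithLp.toLp 2 ![-(x 1), x 0, 0] : EuclideanSpace ℝ (Fin 3))‖ :=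
          mul_le_mul_of_nonneg_left hJ hAG
  · -- the growth of the load piece
    calc expNegInvGlue 3 ^ 3 / (8 * 32 ^ 6) * (2 * p ^ 3) ^ (-(1/3 : ℝ))
        ≤ expNegInvGlue 3 ^ 3 / (8 * 32 ^ 6) * p⁻¹ :=
          mul_le_mul_of_nonneg_left hpr (by positivity)
      _ = (1 - p ^ 8 / 2 - (1 - p ^ 8)) * (p ^ 3 / 32) ^ 3
            * ((p ^ 7)⁻¹ * expNegInvGlue 3 * (p ^ 3 / 32)) ^ 3 / (2 * p ^ 3) ^ 2 := by
          field_simp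
          ring

end Summit.NavierStokesRegularity.NavierStokesRegularity.Theorems
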